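import Literature.Computability.Complexity.AverageCaseDepthHierarchyTypicalRST
import Literature.Computability.Complexity.AverageCaseDepthHierarchyStages
import HarnessLib

/-!
# Losing typicality along the RST process: the `htyp` input of the assembly (RST Props. 10, 11, (27)–(28))

B. Rossman, R. A. Servedio, L.-Y. Tan, *An average-case depth hierarchy theorem for Boolean
circuits*, arXiv:1504.03398 [RossmanServedioTan2015], §10.1 Propositions 10 and 11 (p. 32) and
§10.2 eq. (27)–(28) (pp. 35–36).

For RST's process `rstProc m d` with top stage `d-1`, typicality predicates
`Typ := (rstProc m d).Typ E lo hi (d-1)` (`lo, hi = q w₀ ∓ Δ₀`), this file proves the stage-wise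
bound fed to `ProcParams.V_ge`:
`htyp_rst : j < d-1 → Typ (j+1) τ → P_{ρ ∼ R(τ)}[¬ Typ j ρ̂] ≤ δT`,
with ONE uniform `δT = N (2 e_A + e_B) + w λ` (`N = rstN m d`, `e_A = exp(-(Δ_min/2)²/(16 w q))`,
`e_B = exp(2w(wλ + (1-q/2)^{w/2}) - (E+1))`), by dispatching on the stage (top / middle / last) to
`weight_not_TypMid_le'` / `weight_not_TypFin_le'` with RST's windows, given the elementary
numeric facts `TypFacts m d E` about the parameters (discharged for `m ≥ m₀` in the asymptotics file).
-/

noncomputable section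

namespace Literature.Computability.Complexity

namespace RSTProj

open Finset

/-- The numeric facts about RST's parameters behind the typicality propagation (all consequences
of `m ≥ m₀`, `d ≤ c m / log m`). [cite: RossmanServedioTan2015, §10.1 (pp. 32–34, the `o(1)` and `≪` steps)] -/
structure TypFacts (m d E : ℕ) : Prop where
  /-- `w₀ ≤ w` -/
  w0_le : rstW0 m d ≤ rstW m
  /-- `0 < w₀` -/
  w0_pos : 0 < rstW0 m d
  /-- `0 < m` -/
  m_pos : 0 < m
  /-- `2E ≤ w₀` (hence `2E ≤ w`) -/
  E_le : 2 * E ≤ rstW0 m d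
  /-- the radii are below `q w₀ / 2 ≤ q w / 2` -/
  delta_le : ∀ j, rstDelta m d j ≤ rstQ m * rstW0 m d / 2
  /-- the radii of the genuine stages dominate `Δ_min = w^{1/3}` -/
  delta_ge : ∀ j, j + 2 ≤ d → (rstW m : ℝ) ^ ((1 : ℝ) / 3) ≤ rstDelta m d j
  /-- the radii grow fast enough down the tree: `q w (16 q Δ_{j+1}) + q E ≤ Δ_j / 2` -/
  delta_step : ∀ j, j + 3 ≤ d → rstQ m * rstW m * (16 * rstQ m * rstDelta m d (j + 1)) + rstQ m * E ≤ rstDelta m d j / 2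

/-- The uniform bound on the probability of losing typicality at one stage. [cite: RossmanServedioTan2015, §10.1 Props. 10–11 (p. 32)] -/
def δT (m d E : ℕ) : ℝ :=
  rstN m d * (2 * Real.exp (-(((rstW m : ℝ) ^ ((1 : ℝ) / 3) / 2) ^ 2 / (16 * (rstW m * rstQ m)))) +
      Real.exp (2 * (rstW m * (rstW m * rstLam m + (1 - rstQ m / 2) ^ ((rstW m : ℝ) / 2))) - (E + 1))) +
    rstW m * rstLam m

section

variable {m d E : ℕ} (H : RegimeFacts m d) (T : TypFacts m d E)
include H T

omit H T in
/-- Fan-ins of the process: `W 0 = w₀`, `W j = w` for `1 ≤ j ≤ d-2`, `W (d-1) = m`. [folklore] -/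
theorem W_zero : (rstProc m d).W 0 = rstW0 m d := by show rstWseq m d 0 = _; simp [rstWseq]

omit H T in
/-- `W j = w` strictly inside. [folklore] -/
theorem W_mid {j : ℕ} (h1 : 1 ≤ j) (h2 : j + 2 ≤ d) : (rstProc m d).W j = rstW m := by
  show rstWseq m d j = _; unfold rstWseq; rw [if_neg (by omega), if_neg (by omega)]

omit H T in
/-- `W (d-1) = m`. [folklore] -/
theorem W_top (hd : 2 ≤ d) : (rstProc m d).W (d - 1) = m := by
  show rstWseq m d (d - 1) = _; unfold rstWseq; rw [if_neg (by omega), if_pos (by omega)]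

/-- Every fan-in up to the top is at least one and at most `w`; hence `|Blk W j| ≤ N`. [folklore] -/
theorem card_blk_le {j : ℕ} (hj : j ≤ d) : (Fintype.card (Blk (rstProc m d).W j) : ℝ) ≤ rstN m d := by
  have hd := H.two_le
  have hWpos : ∀ i, i < d → 1 ≤ (rstProc m d).W i := by
    intro i hi
    show 1 ≤ rstWseq m d i
    unfold rstWseq
    split_ifs
    · exact T.w0_pos
    · exact T.m_pos
    · exact le_trans T.w0_pos T.w0_le
  have key : ∀ j, j ≤ d → ∏ i ∈ Finset.range j, (rstProc m d).W i ≤ ∏ i ∈ Finset.range d, (rstProc m d).W i := by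
    intro j hj
    rw [← Finset.prod_range_mul_prod_Ico _ hj]
    refine Nat.le_mul_of_pos_right _ (Finset.prod_pos fun i hi => hWpos i (Finset.mem_Ico.1 hi).2)
  have hN : ∏ i ∈ Finset.range d, (rstProc m d).W i = rstN m d := by
    rw [← card_addr_rstFanins, ← Fintype.card_congr (blkEquivRst hd m), Blk.card]; rfl
  rw [Blk.card]
  exact_mod_cast (hN ▸ key j hj)

omit H T in
/-- Monotonicity of the Gaussian-type tail in its two parameters. [folklore] -/
theorem exp_tail_mono {D D' M M' : ℝ} (hD : D' ≤ D) (hD' : 0 ≤ D') (hM : M ≤ M') (hM0 : 0 < M) :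
    Real.exp (-(D ^ 2 / (4 * M))) ≤ Real.exp (-(D' ^ 2 / (4 * M'))) := by
  apply Real.exp_le_exp.2
  have hM'0 : 0 < M' := lt_of_lt_of_le hM0 hM
  rw [neg_le_neg_iff, div_le_div_iff₀ (by positivity) (by positivity)]
  nlinarith [mul_le_mul hD hD hD' (hD'.trans hD), mul_nonneg (sq_nonneg D') (by linarith : (0:ℝ) ≤ M' - M),
    sq_nonneg D, mul_le_mul_of_nonneg_left hM (sq_nonneg D')]

end

section Cases

variable {m d E : ℕ} (H : RegimeFacts m d) (T : TypFacts m d E)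
include H T

/-- Positivity and size facts used in every case. [folklore] -/
theorem basics : 0 < rstQ m ∧ 0 < (rstW m : ℝ) ∧ 0 < (rstW0 m d : ℝ) ∧ (rstW0 m d : ℝ) ≤ rstW m ∧ 1 ≤ (rstN m d : ℝ) ∧
    0 ≤ rstLam m := by
  have h1 : (rstW0 m d : ℝ) ≤ rstW m := by exact_mod_cast T.w0_le
  have h2 : 0 < (rstW0 m d : ℝ) := by exact_mod_cast T.w0_pos
  have hN : (1 : ℝ) ≤ rstN m d := by
    have := card_blk_le H T (j := 0) (Nat.zero_le _)
    rw [Blk.card] at this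
    simpa using this
  exact ⟨rstQ_pos m, lt_of_lt_of_le h2 h1, h2, h1, hN, rstLam_nonneg m⟩

omit H in
/-- The two exponential failure terms of a stage are dominated by the uniform ones. [folklore] -/
theorem exp_le_eA {D M : ℝ} (j : ℕ) (hj : j + 2 ≤ d) (hD : rstDelta m d j / 2 ≤ D) (hM : M ≤ 4 * (rstW m * rstQ m))
    (hM0 : 0 < M) :
    Real.exp (-(D ^ 2 / (4 * M))) ≤
      Real.exp (-(((rstW m : ℝ) ^ ((1 : ℝ) / 3) / 2) ^ 2 / (16 * (rstW m * rstQ m)))) := by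
  have h := T.delta_ge j hj
  have h0 : 0 ≤ (rstW m : ℝ) ^ ((1 : ℝ) / 3) := Real.rpow_nonneg (Nat.cast_nonneg _) _
  rw [show (16 : ℝ) * (rstW m * rstQ m) = 4 * (4 * (rstW m * rstQ m)) by ring]
  exact exp_tail_mono (by linarith) (by linarith) hM hM0

omit H T in
/-- Polarities alternate. [folklore] -/
theorem o_succ (j : ℕ) : ((rstProc m d).law (j + 1)).o = !((rstProc m d).law j).o := altPol_succ_apply _ j

set_option maxHeartbeats 1000000 in
/-- **Last stage from the all-star top** (`d = 2`: RST (27)–(28) directly under `R_init`). [cite: RossmanServedioTan2015, §10.2 eq. (27)–(28) (pp. 35–36)] -/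
theorem typ_topFin (hd : d = 2) :
    ∑ ρ ∈ univ.filter (fun ρ : BRestr (Blk (rstProc m d).W 1) (Fin ((rstProc m d).W 1)) =>
        ¬ (rstProc m d).TypFin (rstQ m * rstW0 m d - rstDelta m d 0) (rstQ m * rstW0 m d + rstDelta m d 0)
          (liftR ((rstProc m d).law 1).o ρ)), ((rstProc m d).law 1).R ((rstProc m d).allStar 1) ρ ≤ δT m d E := by
  obtain ⟨hq, hw, hw0, hw0w, hN, hlam⟩ := basics H T
  subst hd
  set P := rstProc m 2 with hPdef
  have hLB : (P.law 1).LawBounds (rstQ m) (rstQ m) := H.lawBounds_top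
  have hW0 : P.W 0 = rstW0 m 2 := W_zero
  have hW1 : P.W 1 = m := W_top (d := 2) le_rfl
  have hacc : (P.law 1).acc (P.W 1) = true := by
    rw [hW1]; show rstAcc m 2 1 m = true; simp [rstAcc]
  have hok := ProcParams.childOK_allStar (P := P) (j := 0) hacc (by rw [hW1]; exact T.m_pos.ne') default
  have hΔ0 : 0 ≤ rstDelta m 2 0 := Real.rpow_nonneg (Nat.cast_nonneg _) _
  have hΔle := T.delta_le 0
  have key := ProcParams.weight_not_TypFin_le' (P := P) (o_succ 0) hLB hok.1 (K := (rstW0 m 2 : ℝ))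
    (by rw [hok.2, hW0]) (by rw [hW0]; positivity) (by positivity) hΔ0 (by rw [hW0]; linarith) hΔ0 (by linarith)
    (lo := rstQ m * rstW0 m 2 - rstDelta m 2 0) (hi := rstQ m * rstW0 m 2 + rstDelta m 2 0) (by linarith) (by rw [hW0]; linarith)
  refine key.trans ?_
  have hl : (P.law 1).lam = rstLam m := rfl
  rw [hW0, hl]
  have e1 := exp_le_eA T (D := rstDelta m 2 0) (M := rstW0 m 2 * rstQ m) 0 le_rfl (by linarith) (by nlinarith) (by positivity)
  unfold δT
  have hB : 0 ≤ Real.exp (2 * (rstW m * (rstW m * rstLam m + (1 - rstQ m / 2) ^ ((rstW m : ℝ) / 2))) - (E + 1)) :=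
    (Real.exp_pos _).le
  set eA := Real.exp (-(((rstW m : ℝ) ^ ((1 : ℝ) / 3) / 2) ^ 2 / (16 * (rstW m * rstQ m))))
  have hA : 0 ≤ eA := (Real.exp_pos _).le
  nlinarith [mul_le_mul_of_nonneg_right hN (by positivity : 0 ≤ 2 * eA), mul_nonneg (by linarith : (0:ℝ) ≤ rstN m 2) hB,
    mul_le_mul_of_nonneg_right hw0w hlam]

omit H in
/-- Fan-ins below the top are at most `w`. [folklore] -/
theorem W_le {i : ℕ} (hi : i + 2 ≤ d) : ((rstProc m d).W i : ℝ) ≤ rstW m := by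
  rcases Nat.eq_zero_or_pos i with h0 | hpos
  · subst h0; rw [W_zero]; exact_mod_cast T.w0_le
  · rw [W_mid hpos hi]

omit H T in
/-- Acceptability inside the window, at a stage strictly below the top. [folklore] -/
theorem acc_of_window {j : ℕ} (hj : j + 2 ≤ d) {n : ℕ} (h1 : rstQ m * rstW m - rstDelta m d j < n)
    (h2 : (n : ℝ) < rstQ m * rstW m + rstDelta m d j) : ((rstProc m d).law j).acc n = true := by
  show rstAcc m d j n = true
  unfold rstAcc
  rw [if_neg (by omega), if_neg (by omega), decide_eq_true_iff, abs_le]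
  constructor <;> linarith

omit T in
/-- The determined-count term is dominated by the uniform one. [folklore] -/
theorem det_term_le {a b c : ℝ} (ha : a ≤ rstW m) (ha0 : 0 ≤ a) (hb : b ≤ rstW m)
    (hc : c ≤ (1 - rstQ m / 2) ^ ((rstW m : ℝ) / 2)) :
    Real.exp (2 * (a * (b * rstLam m + c)) - (E + 1)) ≤
      Real.exp (2 * (rstW m * (rstW m * rstLam m + (1 - rstQ m / 2) ^ ((rstW m : ℝ) / 2))) - (E + 1)) := by
  apply Real.exp_le_exp.2
  have hlam := rstLam_nonneg m
  have h1 : b * rstLam m + c ≤ rstW m * rstLam m + (1 - rstQ m / 2) ^ ((rstW m : ℝ) / 2) :=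
    add_le_add (mul_le_mul_of_nonneg_right hb hlam) hc
  have hpos : 0 ≤ rstW m * rstLam m + (1 - rstQ m / 2) ^ ((rstW m : ℝ) / 2) :=
    add_nonneg (mul_nonneg (Nat.cast_nonneg _) hlam) (Real.rpow_nonneg (by linarith [H.q_le, rstQ_pos m]) _)
  by_cases hbc : 0 ≤ b * rstLam m + c
  · nlinarith [mul_le_mul ha h1 hbc (Nat.cast_nonneg _)]
  · push Not at hbc
    nlinarith [mul_nonneg (Nat.cast_nonneg (α := ℝ) (rstW m)) hpos, mul_nonneg ha0 (le_of_lt (neg_pos.2 hbc))]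

omit T in
/-- `(1 - q_lo)^K ≤ (1 - q/2)^{w/2}` when `q_lo ≥ q/2` and `K ≥ w/2`. [folklore] -/
theorem pow_le_half {qlo : ℝ} {K : ℕ} (hqlo : rstQ m / 2 ≤ qlo) (hqlo1 : qlo ≤ 1) (hK : (rstW m : ℝ) / 2 ≤ K) :
    (1 - qlo) ^ K ≤ (1 - rstQ m / 2) ^ ((rstW m : ℝ) / 2) := by
  have hq := rstQ_pos m
  calc (1 - qlo) ^ K ≤ (1 - rstQ m / 2) ^ K := pow_le_pow_left₀ (by linarith) (by linarith) K
    _ = (1 - rstQ m / 2) ^ ((K : ℕ) : ℝ) := (Real.rpow_natCast _ _).symm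
    _ ≤ (1 - rstQ m / 2) ^ ((rstW m : ℝ) / 2) :=
        Real.rpow_le_rpow_of_exponent_ge (by linarith [H.q_le]) (by linarith) hK

/-- The final bookkeeping: `W' λ + e₁ + e₂ ≤ δT` and `N₁ (e₁ + e₂) + N₂ e₃ ≤ δT`. [folklore] -/
theorem le_δT_fin {a e1 e2 : ℝ} (ha : a ≤ rstW m)
    (h1 : e1 ≤ Real.exp (-(((rstW m : ℝ) ^ ((1 : ℝ) / 3) / 2) ^ 2 / (16 * (rstW m * rstQ m)))))
    (h2 : e2 ≤ Real.exp (-(((rstW m : ℝ) ^ ((1 : ℝ) / 3) / 2) ^ 2 / (16 * (rstW m * rstQ m))))) :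
    a * rstLam m + (e1 + e2) ≤ δT m d E := by
  obtain ⟨hq, hw, hw0, hw0w, hN, hlam⟩ := basics H T
  unfold δT
  set eA := Real.exp (-(((rstW m : ℝ) ^ ((1 : ℝ) / 3) / 2) ^ 2 / (16 * (rstW m * rstQ m))))
  set eB := Real.exp (2 * (rstW m * (rstW m * rstLam m + (1 - rstQ m / 2) ^ ((rstW m : ℝ) / 2))) - (E + 1))
  have hA : 0 ≤ eA := (Real.exp_pos _).le
  have hB : 0 ≤ eB := (Real.exp_pos _).le
  nlinarith [mul_le_mul_of_nonneg_right hN (by positivity : 0 ≤ 2 * eA + eB), mul_le_mul_of_nonneg_right ha hlam]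

/-- The final bookkeeping, middle stages. [folklore] -/
theorem le_δT_mid {c1 c2 e1 e2 e3 : ℝ} (hc1 : c1 ≤ rstN m d) (hc2 : c2 ≤ rstN m d)
    (h1 : e1 ≤ Real.exp (-(((rstW m : ℝ) ^ ((1 : ℝ) / 3) / 2) ^ 2 / (16 * (rstW m * rstQ m)))))
    (h2 : e2 ≤ Real.exp (-(((rstW m : ℝ) ^ ((1 : ℝ) / 3) / 2) ^ 2 / (16 * (rstW m * rstQ m)))))
    (he1 : 0 ≤ e1) (he2 : 0 ≤ e2) (he3 : 0 ≤ e3)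
    (h3 : e3 ≤ Real.exp (2 * (rstW m * (rstW m * rstLam m + (1 - rstQ m / 2) ^ ((rstW m : ℝ) / 2))) - (E + 1))) :
    c1 * (e1 + e2) + c2 * e3 ≤ δT m d E := by
  obtain ⟨hq, hw, hw0, hw0w, hN, hlam⟩ := basics H T
  unfold δT
  set eA := Real.exp (-(((rstW m : ℝ) ^ ((1 : ℝ) / 3) / 2) ^ 2 / (16 * (rstW m * rstQ m))))
  set eB := Real.exp (2 * (rstW m * (rstW m * rstLam m + (1 - rstQ m / 2) ^ ((rstW m : ℝ) / 2))) - (E + 1))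
  have hA : 0 ≤ eA := (Real.exp_pos _).le
  have hB : 0 ≤ eB := (Real.exp_pos _).le
  have hwl : 0 ≤ (rstW m : ℝ) * rstLam m := mul_nonneg hw.le hlam
  nlinarith [mul_le_mul hc1 (add_le_add h1 h2) (by positivity) (by linarith), mul_le_mul hc2 h3 he3 (by linarith)]

set_option maxHeartbeats 1000000 in
/-- **Last stage from a typical middle stage** (`d ≥ 3`: RST (27)–(28)). [cite: RossmanServedioTan2015, §10.2 eq. (27)–(28) (pp. 35–36)] -/
theorem typ_midFin (hd : 3 ≤ d) (τ : BRestr (Blk (rstProc m d).W 1) (Fin ((rstProc m d).W 1)))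
    (hτ : (rstProc m d).TypMid E 0 τ) :
    ∑ ρ ∈ univ.filter (fun ρ : BRestr (Blk (rstProc m d).W 1) (Fin ((rstProc m d).W 1)) =>
        ¬ (rstProc m d).TypFin (rstQ m * rstW0 m d - rstDelta m d 0) (rstQ m * rstW0 m d + rstDelta m d 0)
          (liftR ((rstProc m d).law 1).o ρ)), ((rstProc m d).law 1).R τ ρ ≤ δT m d E := by
  obtain ⟨hq, hw, hw0, hw0w, hN, hlam⟩ := basics H T
  set η := 16 * rstQ m * rstDelta m d 1 with hη
  have hLB : ((rstProc m d).law 1).LawBounds (rstQ m * (1 - η)) (rstQ m * (1 + η)) := H.lawBounds_mid (k := 1) le_rfl hd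
  have hW0 : (rstProc m d).W 0 = rstW0 m d := W_zero
  have eW0 : (((rstProc m d).W 0 : ℕ) : ℝ) = rstW0 m d := by exact_mod_cast hW0
  have hok := ProcParams.childOK_of_TypMid (P := rstProc m d) hτ default
  have hΔ0 : 0 ≤ rstDelta m d 0 := Real.rpow_nonneg (Nat.cast_nonneg _) _
  have hΔ1 : 0 ≤ rstDelta m d 1 := Real.rpow_nonneg (Nat.cast_nonneg _) _
  have hΔle := T.delta_le 0
  have hη0 : 0 ≤ η := by rw [hη]; positivity
  have hη4 : η ≤ 1 / 4 := by have := H.delta_small 1; rw [hη]; linarith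
  have hE2 : 2 * (E : ℝ) ≤ rstW0 m d := by have := T.E_le; exact_mod_cast this
  have hE0 : (0 : ℝ) ≤ E := Nat.cast_nonneg _
  have hEw0 : E ≤ (rstProc m d).W 0 := by rw [hW0]; have := T.E_le; omega
  -- `K = w₀ - E`
  have hKle : (rstW0 m d : ℝ) - E ≤ (((rstProc m d).law 1).undet τ default).card := by
    have h' : ((((rstProc m d).W 0 - E : ℕ)) : ℝ) ≤ (((rstProc m d).law 1).undet τ default).card := by exact_mod_cast hok.2
    rw [Nat.cast_sub hEw0, eW0] at h'
    exact h'
  have hqwη : rstQ m * rstW0 m d * η + rstQ m * E ≤ rstDelta m d 0 / 2 := by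
    have h1 : rstQ m * rstW0 m d * η ≤ rstQ m * rstW m * η :=
      mul_le_mul_of_nonneg_right (mul_le_mul_of_nonneg_left hw0w hq.le) hη0
    have h2 := T.delta_step 0 hd
    rw [← hη] at h2; linarith
  -- the windows
  set Δp := rstQ m * rstW0 m d + rstDelta m d 0 - rstW0 m d * (rstQ m * (1 + η)) with hΔp
  set Δm := (rstW0 m d - E) * (rstQ m * (1 - η)) - (rstQ m * rstW0 m d - rstDelta m d 0) with hΔm
  have hqEη : 0 ≤ rstQ m * E * η := mul_nonneg (mul_nonneg hq.le hE0) hη0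
  have hqwη0 : 0 ≤ rstQ m * rstW0 m d * η := mul_nonneg (mul_nonneg hq.le hw0.le) hη0
  have hqE : rstQ m * E ≤ rstQ m * rstW0 m d / 2 := by nlinarith
  have hqEη1 : rstQ m * E * η ≤ rstQ m * E := mul_le_of_le_one_right (mul_nonneg hq.le hE0) (by linarith)
  have hqwη4 : rstQ m * rstW0 m d * η ≤ rstQ m * rstW0 m d / 4 := by
    have := mul_le_mul_of_nonneg_left hη4 (mul_nonneg hq.le hw0.le); linarith
  have eΔp : Δp = rstDelta m d 0 - rstQ m * rstW0 m d * η := by rw [hΔp]; ring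
  have eΔm : Δm = rstDelta m d 0 - rstQ m * E + rstQ m * E * η - rstQ m * rstW0 m d * η := by rw [hΔm]; ring
  have hΔp1 : rstDelta m d 0 / 2 ≤ Δp := by rw [eΔp]; linarith [mul_nonneg hq.le hE0]
  have hΔm1 : rstDelta m d 0 / 2 ≤ Δm := by rw [eΔm]; linarith
  have hΔp2 : Δp ≤ rstDelta m d 0 := by rw [eΔp]; linarith
  have hΔm2 : Δm ≤ rstDelta m d 0 := by rw [eΔm]; linarith
  have eMhi : (rstW0 m d : ℝ) * (rstQ m * (1 + η)) = rstQ m * rstW0 m d + rstQ m * rstW0 m d * η := by ring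
  have eMlo : ((rstW0 m d : ℝ) - E) * (rstQ m * (1 - η)) =
      rstQ m * rstW0 m d - rstQ m * E - rstQ m * rstW0 m d * η + rstQ m * E * η := by ring
  have hqw0 : 0 < rstQ m * rstW0 m d := mul_pos hq hw0
  have hMhi : 0 < (rstW0 m d : ℝ) * (rstQ m * (1 + η)) := by rw [eMhi]; linarith
  have hMlo : 0 < ((rstW0 m d : ℝ) - E) * (rstQ m * (1 - η)) := by rw [eMlo]; linarith
  have hM1 : (rstW0 m d : ℝ) * (rstQ m * (1 + η)) ≤ 4 * (rstW m * rstQ m) := by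
    rw [eMhi]; nlinarith [mul_le_mul_of_nonneg_left hw0w hq.le]
  have hM2 : ((rstW0 m d : ℝ) - E) * (rstQ m * (1 - η)) ≤ 4 * (rstW m * rstQ m) := by
    rw [eMlo]; nlinarith [mul_le_mul_of_nonneg_left hw0w hq.le]
  have c1 : 0 < (((rstProc m d).W 0 : ℕ) : ℝ) * (rstQ m * (1 + η)) := by rw [eW0]; exact hMhi
  have c4 : Δp ≤ 2 * ((((rstProc m d).W 0 : ℕ) : ℝ) * (rstQ m * (1 + η))) := by
    rw [eW0, eMhi]; linarith only [hΔp2, hΔle, hqwη0, hqw0]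
  have c6 : Δm ≤ 2 * (((rstW0 m d : ℝ) - E) * (rstQ m * (1 - η))) := by
    rw [eMlo]; linarith only [hΔm2, hΔle, hqE, hqwη4, hqEη]
  have c9 : (((rstProc m d).W 0 : ℕ) : ℝ) * (rstQ m * (1 + η)) + Δp ≤ rstQ m * rstW0 m d + rstDelta m d 0 := by
    rw [eW0, eMhi, eΔp]; linarith only
  have key := ProcParams.weight_not_TypFin_le' (P := rstProc m d) (o_succ 0) hLB hok.1 (K := (rstW0 m d : ℝ) - E) hKle
    c1 hMlo (Δp := Δp) (Δm := Δm) (by linarith only [hΔp1, hΔ0]) c4 (by linarith only [hΔm1, hΔ0]) c6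
    (lo := rstQ m * rstW0 m d - rstDelta m d 0) (hi := rstQ m * rstW0 m d + rstDelta m d 0)
    (le_of_eq (by rw [hΔm]; ring)) c9
  refine key.trans ?_
  have hl : ((rstProc m d).law 1).lam = rstLam m := rfl
  rw [eW0, hl]
  exact le_δT_fin H T hw0w (exp_le_eA T 0 (by omega) hΔp1 hM1 hMhi) (exp_le_eA T 0 (by omega) hΔm1 hM2 hMlo)

set_option maxHeartbeats 1000000 in
/-- **Below the all-star top stage** (`d ≥ 3`: RST Prop. 10, the lift of `ρ ← R_init` is typical). [cite: RossmanServedioTan2015, §10.1 Prop. 10 (p. 32)] -/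
theorem typ_topMid {j' : ℕ} (hj : j' + 3 = d) :
    ∑ ρ ∈ univ.filter (fun ρ : BRestr (Blk (rstProc m d).W (j' + 1 + 1)) (Fin ((rstProc m d).W (j' + 1 + 1))) =>
        ¬ (rstProc m d).TypMid E j' (liftR ((rstProc m d).law (j' + 1 + 1)).o ρ)),
      ((rstProc m d).law (j' + 1 + 1)).R ((rstProc m d).allStar (j' + 1 + 1)) ρ ≤ δT m d E := by
  obtain ⟨hq, hw, hw0, hw0w, hN, hlam⟩ := basics H T
  have hd1 : d - 1 = j' + 1 + 1 := by omega
  have hLB : ((rstProc m d).law (j' + 1 + 1)).LawBounds (rstQ m) (rstQ m) := by have := H.lawBounds_top; rwa [hd1] at this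
  have hWt : (rstProc m d).W (j' + 1 + 1) = m := by have := W_top (m := m) (d := d) (by omega); rwa [hd1] at this
  have hW1 : (rstProc m d).W (j' + 1) = rstW m := W_mid (by omega) (by omega)
  have eW1 : (((rstProc m d).W (j' + 1) : ℕ) : ℝ) = rstW m := by exact_mod_cast hW1
  have hacc : ((rstProc m d).law (j' + 1 + 1)).acc ((rstProc m d).W (j' + 1 + 1)) = true := by
    rw [hWt]; show rstAcc m d (j' + 1 + 1) m = true
    unfold rstAcc; rw [if_neg (by omega), if_pos (by omega)]; simp
  have hok := fun g => ProcParams.childOK_allStar (P := rstProc m d) (j := j' + 1) hacc (by rw [hWt]; exact T.m_pos.ne') g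
  have hΔ : 0 ≤ rstDelta m d (j' + 1) := Real.rpow_nonneg (Nat.cast_nonneg _) _
  have hΔle : rstDelta m d (j' + 1) ≤ rstQ m * rstW m / 2 := by have := T.delta_le (j' + 1); nlinarith
  have hM : 0 < (rstW m : ℝ) * rstQ m := by positivity
  have key := ProcParams.weight_not_TypMid_le' (P := rstProc m d) (o_succ (j' + 1)) hLB (by linarith [H.q_le])
    (fun g => (hok g).1) (K := rstW m) (fun g => by rw [(hok g).2, hW1]) (by rw [eW1]; exact hM) hM
    (Δp := rstDelta m d (j' + 1)) (Δm := rstDelta m d (j' + 1)) hΔ (by rw [eW1]; linarith) hΔ (by linarith) (by linarith)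
    (fun n h1 h2 => acc_of_window (by omega) (by linarith) (by rw [eW1] at h2; linarith)) E
  refine key.trans ?_
  have hl : ((rstProc m d).law (j' + 1 + 1)).lam = rstLam m := rfl
  rw [eW1, hl]
  have e1 := exp_le_eA T (D := rstDelta m d (j' + 1)) (M := rstW m * rstQ m) (j' + 1) (by omega) (by linarith) (by nlinarith) hM
  refine le_δT_mid H T (card_blk_le H T (by omega)) (card_blk_le H T (by omega)) e1 e1
    (Real.exp_pos _).le (Real.exp_pos _).le (Real.exp_pos _).le ?_
  exact det_term_le H (W_le T (i := j') (by omega)) (Nat.cast_nonneg _) le_rfl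
    (pow_le_half H (qlo := rstQ m) (by linarith) (by linarith [H.q_le]) (by linarith))

set_option maxHeartbeats 1000000 in
/-- **Typical yields typical, middle stages** (RST Prop. 11). [cite: RossmanServedioTan2015, §10.1 Prop. 11 (pp. 32–34)] -/
theorem typ_midMid {j' : ℕ} (hj : j' + 4 ≤ d) (τ : BRestr (Blk (rstProc m d).W (j' + 1 + 1)) (Fin ((rstProc m d).W (j' + 1 + 1))))
    (hτ : (rstProc m d).TypMid E (j' + 1) τ) :
    ∑ ρ ∈ univ.filter (fun ρ : BRestr (Blk (rstProc m d).W (j' + 1 + 1)) (Fin ((rstProc m d).W (j' + 1 + 1))) =>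
        ¬ (rstProc m d).TypMid E j' (liftR ((rstProc m d).law (j' + 1 + 1)).o ρ)),
      ((rstProc m d).law (j' + 1 + 1)).R τ ρ ≤ δT m d E := by
  obtain ⟨hq, hw, hw0, hw0w, hN, hlam⟩ := basics H T
  set η := 16 * rstQ m * rstDelta m d (j' + 1 + 1) with hη
  have hLB : ((rstProc m d).law (j' + 1 + 1)).LawBounds (rstQ m * (1 - η)) (rstQ m * (1 + η)) :=
    H.lawBounds_mid (k := j' + 1 + 1) (by omega) hj
  have hW1 : (rstProc m d).W (j' + 1) = rstW m := W_mid (by omega) (by omega)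
  have eW1 : (((rstProc m d).W (j' + 1) : ℕ) : ℝ) = rstW m := by exact_mod_cast hW1
  have hok := fun g => ProcParams.childOK_of_TypMid (P := rstProc m d) hτ g
  have hΔ : 0 ≤ rstDelta m d (j' + 1) := Real.rpow_nonneg (Nat.cast_nonneg _) _
  have hΔle : rstDelta m d (j' + 1) ≤ rstQ m * rstW m / 2 := by have := T.delta_le (j' + 1); nlinarith
  have hη0 : 0 ≤ η := by
    rw [hη]; exact mul_nonneg (mul_nonneg (by norm_num) hq.le) (Real.rpow_nonneg (Nat.cast_nonneg _) _)
  have hη4 : η ≤ 1 / 4 := by have := H.delta_small (j' + 1 + 1); rw [hη]; linarith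
  have hE2 : 2 * (E : ℝ) ≤ rstW m := by
    have := T.E_le; have h' : ((2 * E : ℕ) : ℝ) ≤ rstW0 m d := by exact_mod_cast this
    push_cast at h'; linarith
  have hE0 : (0 : ℝ) ≤ E := Nat.cast_nonneg _
  have hEw : E ≤ rstW m := by have := T.E_le; have := T.w0_le; omega
  have hKcast : ((rstW m - E : ℕ) : ℝ) = rstW m - E := Nat.cast_sub hEw
  have hqwη : rstQ m * rstW m * η + rstQ m * E ≤ rstDelta m d (j' + 1) / 2 := by
    have h2 := T.delta_step (j' + 1) (by omega); rw [← hη] at h2; exact h2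
  set Δp := rstQ m * rstW m + rstDelta m d (j' + 1) - rstW m * (rstQ m * (1 + η)) with hΔp
  set Δm := (rstW m - E) * (rstQ m * (1 - η)) - (rstQ m * rstW m - rstDelta m d (j' + 1)) with hΔm
  have hqEη : 0 ≤ rstQ m * E * η := mul_nonneg (mul_nonneg hq.le hE0) hη0
  have hqwη0 : 0 ≤ rstQ m * rstW m * η := mul_nonneg (mul_nonneg hq.le hw.le) hη0
  have hqE : rstQ m * E ≤ rstQ m * rstW m / 2 := by nlinarith
  have hqEη1 : rstQ m * E * η ≤ rstQ m * E := mul_le_of_le_one_right (mul_nonneg hq.le hE0) (by linarith)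
  have hqwη4 : rstQ m * rstW m * η ≤ rstQ m * rstW m / 4 := by
    have := mul_le_mul_of_nonneg_left hη4 (mul_nonneg hq.le hw.le); linarith
  have eΔp : Δp = rstDelta m d (j' + 1) - rstQ m * rstW m * η := by rw [hΔp]; ring
  have eΔm : Δm = rstDelta m d (j' + 1) - rstQ m * E + rstQ m * E * η - rstQ m * rstW m * η := by rw [hΔm]; ring
  have hΔp1 : rstDelta m d (j' + 1) / 2 ≤ Δp := by rw [eΔp]; linarith [mul_nonneg hq.le hE0]
  have hΔm1 : rstDelta m d (j' + 1) / 2 ≤ Δm := by rw [eΔm]; linarith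
  have hΔp2 : Δp ≤ rstDelta m d (j' + 1) := by rw [eΔp]; linarith
  have hΔm2 : Δm ≤ rstDelta m d (j' + 1) := by rw [eΔm]; linarith
  have eMhi : (rstW m : ℝ) * (rstQ m * (1 + η)) = rstQ m * rstW m + rstQ m * rstW m * η := by ring
  have eMlo : ((rstW m : ℝ) - E) * (rstQ m * (1 - η)) =
      rstQ m * rstW m - rstQ m * E - rstQ m * rstW m * η + rstQ m * E * η := by ring
  have hqw : 0 < rstQ m * rstW m := mul_pos hq hw
  have hMhi : 0 < (rstW m : ℝ) * (rstQ m * (1 + η)) := by rw [eMhi]; linarith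
  have hMlo : 0 < ((rstW m : ℝ) - E) * (rstQ m * (1 - η)) := by rw [eMlo]; linarith
  have hM1 : (rstW m : ℝ) * (rstQ m * (1 + η)) ≤ 4 * (rstW m * rstQ m) := by rw [eMhi]; nlinarith
  have hM2 : ((rstW m : ℝ) - E) * (rstQ m * (1 - η)) ≤ 4 * (rstW m * rstQ m) := by rw [eMlo]; nlinarith
  have hK : ∀ g, rstW m - E ≤ (((rstProc m d).law (j' + 1 + 1)).undet τ g).card := fun g =>
    calc rstW m - E = (rstProc m d).W (j' + 1) - E := by rw [hW1]
      _ ≤ _ := (hok g).2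
  have hq1 : rstQ m * (1 - η) ≤ 1 := by nlinarith [H.q_le]
  have c1 : 0 < (((rstProc m d).W (j' + 1) : ℕ) : ℝ) * (rstQ m * (1 + η)) := by rw [eW1]; exact hMhi
  have c2 : 0 < ((rstW m - E : ℕ) : ℝ) * (rstQ m * (1 - η)) := by rw [hKcast]; exact hMlo
  have c3 : 0 ≤ Δp := by linarith only [hΔp1, hΔ]
  have c4 : Δp ≤ 2 * ((((rstProc m d).W (j' + 1) : ℕ) : ℝ) * (rstQ m * (1 + η))) := by
    rw [eW1, eMhi]; linarith only [hΔp2, hΔle, hqwη0, hqw]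
  have c5 : 0 ≤ Δm := by linarith only [hΔm1, hΔ]
  have c6 : Δm ≤ 2 * (((rstW m - E : ℕ) : ℝ) * (rstQ m * (1 - η))) := by
    rw [hKcast, eMlo]; linarith only [hΔm2, hΔle, hqE, hqwη4, hqEη]
  have c7 : 0 ≤ ((rstW m - E : ℕ) : ℝ) * (rstQ m * (1 - η)) - Δm := by
    rw [hKcast, eMlo, eΔm]; linarith only [hΔle, hqw]
  have c8 : ∀ n : ℕ, ((rstW m - E : ℕ) : ℝ) * (rstQ m * (1 - η)) - Δm < n →
      (n : ℝ) < (((rstProc m d).W (j' + 1) : ℕ) : ℝ) * (rstQ m * (1 + η)) + Δp → ((rstProc m d).law (j' + 1)).acc n = true := by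
    intro n h1 h2
    rw [hKcast, eMlo, eΔm] at h1
    rw [eW1, eMhi, eΔp] at h2
    exact acc_of_window (by omega) (by linarith only [h1]) (by linarith only [h2])
  have key := ProcParams.weight_not_TypMid_le' (P := rstProc m d) (o_succ (j' + 1)) hLB hq1 (fun g => (hok g).1)
    (K := rstW m - E) hK c1 c2 c3 c4 c5 c6 c7 c8 E
  refine key.trans ?_
  have hl : ((rstProc m d).law (j' + 1 + 1)).lam = rstLam m := rfl
  rw [eW1, hl, hKcast]
  refine le_δT_mid H T (card_blk_le H T (by omega)) (card_blk_le H T (by omega))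
    (exp_le_eA T (j' + 1) (by omega) hΔp1 hM1 hMhi) (exp_le_eA T (j' + 1) (by omega) hΔm1 hM2 hMlo)
    (Real.exp_pos _).le (Real.exp_pos _).le (Real.exp_pos _).le ?_
  have hqlo1 : rstQ m / 2 ≤ rstQ m * (1 - η) := by
    have h := mul_le_mul_of_nonneg_left hη4 hq.le; linarith only [h, hq]
  exact det_term_le H (W_le T (i := j') (by omega)) (Nat.cast_nonneg _) le_rfl
    (pow_le_half H hqlo1 hq1 (by rw [hKcast]; linarith))

/-! ### The dispatcher -/

set_option maxHeartbeats 2000000 in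
/-- **Losing typicality at any stage of RST's process costs at most `δT`** — the `htyp` input of
`ProcParams.V_ge` for `rstProc m d` with the typicality predicates `ProcParams.Typ` run from the
all-star top stage `d-1` and the final window `q w₀ ∓ Δ₀`. [cite: RossmanServedioTan2015, §10.1 Props. 10–11 (p. 32) and §10.2 eq. (27)–(28) (pp. 35–36)] -/
theorem htyp_rst :
    ∀ (j : ℕ) (τ : BRestr (Blk (rstProc m d).W (j + 1)) (Fin ((rstProc m d).W (j + 1)))), j < d - 1 →
      (rstProc m d).Typ E (rstQ m * rstW0 m d - rstDelta m d 0) (rstQ m * rstW0 m d + rstDelta m d 0) (d - 1) (j + 1) τ →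
      ∑ ρ ∈ univ.filter (fun ρ => ¬ (rstProc m d).Typ E (rstQ m * rstW0 m d - rstDelta m d 0)
          (rstQ m * rstW0 m d + rstDelta m d 0) (d - 1) j (liftR ((rstProc m d).law (j + 1)).o ρ)),
        ((rstProc m d).law (j + 1)).R τ ρ ≤ δT m d E := by
  classical
  intro j τ hj hτ
  by_cases htop : j + 1 = d - 1
  · -- from the all-star top stage
    have hτ' : τ = (rstProc m d).allStar (j + 1) := by
      simp only [ProcParams.Typ, if_pos htop] at hτ; exact hτ
    subst hτ'
    rcases j with _ | j'
    · exact typ_topFin H T (by omega)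
    · have hne : j' + 1 ≠ d - 1 := by omega
      have e : univ.filter (fun ρ : BRestr (Blk (rstProc m d).W (j' + 1 + 1)) (Fin ((rstProc m d).W (j' + 1 + 1))) =>
          ¬ (rstProc m d).Typ E (rstQ m * rstW0 m d - rstDelta m d 0) (rstQ m * rstW0 m d + rstDelta m d 0) (d - 1) (j' + 1)
            (liftR ((rstProc m d).law (j' + 1 + 1)).o ρ)) =
          univ.filter (fun ρ : BRestr (Blk (rstProc m d).W (j' + 1 + 1)) (Fin ((rstProc m d).W (j' + 1 + 1))) =>
            ¬ (rstProc m d).TypMid E j' (liftR ((rstProc m d).law (j' + 1 + 1)).o ρ)) :=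
        Finset.filter_congr fun ρ _ => by simp only [ProcParams.Typ, if_neg hne]
      rw [e]
      exact typ_topMid H T (by omega)
  · -- from a typical middle stage
    have hτ' : (rstProc m d).TypMid E j τ := by
      simp only [ProcParams.Typ, if_neg htop] at hτ; exact hτ
    rcases j with _ | j'
    · exact typ_midFin H T (by omega) τ hτ'
    · have hne : j' + 1 ≠ d - 1 := by omega
      have e : univ.filter (fun ρ : BRestr (Blk (rstProc m d).W (j' + 1 + 1)) (Fin ((rstProc m d).W (j' + 1 + 1))) =>
          ¬ (rstProc m d).Typ E (rstQ m * rstW0 m d - rstDelta m d 0) (rstQ m * rstW0 m d + rstDelta m d 0) (d - 1) (j' + 1)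
            (liftR ((rstProc m d).law (j' + 1 + 1)).o ρ)) =
          univ.filter (fun ρ : BRestr (Blk (rstProc m d).W (j' + 1 + 1)) (Fin ((rstProc m d).W (j' + 1 + 1))) =>
            ¬ (rstProc m d).TypMid E j' (liftR ((rstProc m d).law (j' + 1 + 1)).o ρ)) :=
        Finset.filter_congr fun ρ _ => by simp only [ProcParams.Typ, if_neg hne]
      rw [e]
      exact typ_midMid H T (by omega) τ hτ'

end Cases

end RSTProj

end Literature.Computability.Complexity

end
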